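import Summits.QuantumFields.BalabanUV.Beta.D1BFx.DshWordSplitTadpole
import Summits.QuantumFields.BalabanUV.Beta.D1BFx.ChartDefectRowsDshMass
import Summits.QuantumFields.BalabanUV.Beta.D1BFx.DressedColumnRibbon

/-!
# `BalabanUV.Beta.D1BFx.ChartDefectRowDdUniform` — road «BF-x», binder row D1, PART 24-hyb HEAD (OWNER d1-p2 g25 `ChartDefectHead` v1.1 `hWdd`∕`hAdd`∕`hBdd`∕`hDdd`;
# `ChartDefectHeadScales`: constants bound BEFORE `m`): **THE HEAD's ROW (dd) AT ITS OWN PIN `G₀ = coDressKBmAt (ctr 4 n) n (KInvStep 3 n 0)` IS A (5.10)-KERNEL WITH AN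
# `n`-FREE, HYPOTHESIS-FREE CONSTANT — `Decay510 (z₀ ↦ ½·tadpole G₀ ([Λc e z₀,[Λc a 0, Dsh n]])) (32·(C_int′ + 4·C_G′)·(Cλe^{κ′∕2})²·(e^{2κ′}+1)²·Zl 4 (κ′∕8)) (κ′∕8)`:
# interior bonds pay `n⁻⁵` (L-h♭ `DressedColumnRibbon`) × the `Dsh` block mass `n⁵` (O-6), face-crossing bonds `n⁻⁴` («G0-COL-ENV») × the `Dsh` face mass `n⁴` (O-6′)** (FILE 6, last of the chain)

HONEST DEPENDENCY (cell records, verbatim): «continuum YM on T⁴ ⇐ BetaPertH ∧ nine spine estimates (0/9 proved); BetaPertH ⇐ (D1) ∧ (D4) ∧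
CAP+tail; G-an2-4 gates asym, D1 and NE2/3/4.»  HONEST FRAMING (cell contract, verbatim): «discharging `BetaPertH` makes Bałaban's UV stability
UNCONDITIONAL — a real constructive-QFT result; it is NOT the continuum limit and NOT the Clay problem.»  THIS MODULE is [folklore] ∕ [our objects] bookkeeping BY NAME over
LANDED objects: FILES 3 ∕ 5 (`ChartDefectRowsDshMass.abs_lockedWeight_legSite_le ∕ abs_colH_G₀_le_const`, `DshWordSplitTadpole.decay510_half_tadpole_word_split`), my lineage's
g30 L-h♭ `DressedColumnRibbon.abs_colH_G₀_road_interior_le` (the dressed column is `n⁻⁵` on bonds inside a block — gan24-leaf-02's «undressed minus an exact gradient» +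
`AxialRibbon` + `MinimiserColumnGradient`), gan24-leaf-05 g53 «G0-COL-ENV» `PackedColumnEnvelope.abs_colH_G₀_road_le` (`n⁻⁴` everywhere), an2's `BubbleParity.
trK_coDressKBmAt_KInvStep`; lit `absMoment₂_of_decay510`, `secondMoment_abs_le_of_decay510`.  No `def`, no `def … : Prop`, nothing cited, NO printed hypothesis, 0 sorry.
WHAT IT IS: ONE of the eight displayed rows of the HEAD, priced at the HEAD's own pin with a constant in which NO power of `n` is left — the located count of the g32 memo §5
(«interior mass `n⁵` × `n⁻⁵` + face mass `n⁴` × `n⁻⁴` = O(1) + O(1)») AS A THEOREM.  WHAT IT IS NOT: the HEAD (seven rows remain, two of them — (xb) (bb) — read the leg's ff and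
mm blocks); a binder discharge (0∕4 row-D1 binders: hW ∕ hR ∕ D1Tel ∕ D1Rep); (K) NOT closed; (J1) ONE OPEN ROW; NOT D1, NEVER «G-an2-4 closed», NOT `BetaPertH`, NOT continuum, NOT Clay.

ABSOLUTE RULE (cell charter, verbatim): «No internally-minted statement may enter as a cited fact. Every hypothesis is either kernel-proved in
this package or a verbatim quotation of a PUBLISHED theorem with page reference. The manuscript(s) under audit are NOT citable for their own
disputed steps — they are the thing under adjudication; programme-internal (2001/route/tribunal) claims are never citable.»

CONTENT (`C_int′ := 8·MD163 4·periodConst (κ₁₆₃ 4) 3·e^{κ₁₆₃(4)∕4}`, `C_G′ := C₄·(1 + 8(1 + e^{κ₁₆₃(4)∕4}))·e^{κ₁₆₃(4)∕4}`, `C₄ := MG163 4·periodConst (κ₁₆₃ 4) 3`, `Cλ := 4·(MG163 (3+1)·periodConst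
(kappa163 (3+1)) 3)·e^{κ′}`, `κ′ := kappa163 (3+1)∕((3:ℝ)+1)`).
* §10 **`decay510_row_dd_split`** (any sign-symmetric leg with interior∕face column letters `Si`∕`Sf`: NET `Si·n⁵ + Sf·n⁴`, every cofactor closed);
  `abs_colH_G₀_interior_le_const`; **`decay510_row_dd_road_uniform`** (the HEAD's `hDdd` at its own pin, n-FREE); **`row_dd_road_uniform`** (`hAdd` ∧ `hBdd` shapes, n-FREE).
Unit `b2b-balaban-beta-d1-formalise-leaf-01` (gen 33), road «BF-x»; OFFER O-10 part 3.  Not in print; our bookkeeping.  No existing file touched.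
-/

noncomputable section

namespace Summit.QuantumFields.BalabanUV.Beta.D1BFx.ChartDefectRowDdUniform

open Finset
open scoped BigOperators
open Literature.MathematicalPhysics.QuantumFieldTheory
open Literature.MathematicalPhysics.QuantumFieldTheory.LatticeForm (quo)
open Literature.MathematicalPhysics.QuantumFieldTheory.Balaban1983to89
open Literature.MathematicalPhysics.QuantumFieldTheory.Balaban1983to89.Beta
open B12Sec2to5 (l1 l1_nonneg Decay510 secondMoment_abs_le_of_decay510)
open DecimatedMomentSummable (AbsMoment₂ absMoment₂_of_decay510)
open ExpKernelCalculus (MKer Zl comp tr tadpole decay510_mono_const)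
open OneStepResolventKernel (Fib)
open OneStepKernelFamily (colH KInvStep)
open AffineAveraging (Site unitVec)
open AveragingContours (blk)
open AveragingContoursRooted (ctr ctrOff ctrOff_mem_box)
open Summit.QuantumFields.BalabanUV.Beta.BorderedHessian (diagK sgnK)
open Summit.QuantumFields.BalabanUV.Beta.TameKernelCalculus (trK)
open Summit.QuantumFields.BalabanUV.Beta.BubbleParity (trK_coDressKBmAt_KInvStep)
open Summit.QuantumFields.BalabanUV.Beta.AxialDressingRooted (coDressKBmAt)
open Summit.QuantumFields.BalabanUV.Beta.DshAn1 (Dsh)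
open Summit.QuantumFields.BalabanUV.Beta.AxialProjectorBlockMean (bmGaugeAt)
open Summit.QuantumFields.BalabanUV.Beta.AveragingWardRootedStencils (legSite)
open Summit.QuantumFields.BalabanUV.Beta.D1BFx.DressedColumnRibbon (abs_colH_G₀_road_interior_le)
open Summit.QuantumFields.BalabanUV.Beta.D1BFx.MinimiserColumnGradient (colH_KInvStep_zero_diff_road_weight_nonneg)
open Summit.QuantumFields.BalabanUV.Beta.D1BFx.ChartDefectRowsDshMass (abs_lockedWeight_legSite_le abs_colH_G₀_le_const)
open Summit.QuantumFields.BalabanUV.Beta.D1BFx.DshWordSplitTadpole (decay510_half_tadpole_word_split)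
open B5Hk163Strip (kappa163 kappa163_pos)
open B5Hk163Decay (MG163)
open B5Hk163TorusHolderDecay (MD163)
open B4TorusKernel (periodConst)

/-! ## §10 THE FACE SPLIT AT THE RECORD: row (dd) with interior ∕ face column letters; at the HEAD's own pin the constant is `n`-FREE -/

section Uniform

variable {n : ℕ} [NeZero n]

/-- **ROW (dd) OF THE HEAD, FACE-SPLIT** [our objects + folklore]: for ANY sign-symmetric packed leg (`trK G = sgnK G`) with interior ∕ face column letters
`|colH G n μ Y κ u| ≤ Si` on bonds inside a block, `≤ Sf` on all bonds (`0 ≤ Si, Sf`):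
`Decay510 (z₀ ↦ ½·tadpole G ([Λc e z₀, [Λc a 0, Dsh n]])) (½·2·(Cλe^{κ′∕2})²·(e^{2κ′}+1)²·(4·(2·(Si·T₀ + Sf·F₀)))·Zl 4 (κ′∕8)) (κ′∕8)`, `T₀ = n^{3+1}·((3+1)·n)` (O-6),
`F₀ = (3+1)·((3+1)·n^{3+1})` (O-6′) — NET `Si·n⁵ + Sf·n⁴`. -/
theorem decay510_row_dd_split {G : MKer (3 + 1) (Fib 3)} {Si Sf : ℝ} (hSi : 0 ≤ Si) (hSf : 0 ≤ Sf) (hsym : trK G = sgnK G)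
    (hcolI : ∀ (μ : Fin (3 + 1)) (Y : Site (3 + 1)) (κ : Fin (3 + 1)) (u : Site (3 + 1)), blk n (u + unitVec κ) = blk n u → |colH G n μ Y κ u| ≤ Si)
    (hcolF : ∀ (μ : Fin (3 + 1)) (Y : Site (3 + 1)) (κ : Fin (3 + 1)) (u : Site (3 + 1)), |colH G n μ Y κ u| ≤ Sf) (a e : Fin 4) :
    Decay510 (fun z₀ : Site 4 => (1 / 2 : ℝ) * tadpole G
        (comp (diagK fun z' b => (n : ℝ) ^ 4 / 2 * bmGaugeAt (ctr 4 n) (colH (KInvStep (d := 3) n 0) n e z₀) n (legSite (ctr 4 n) z' b))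
            (comp (diagK fun z' b => (n : ℝ) ^ 4 / 2 * bmGaugeAt (ctr 4 n) (colH (KInvStep (d := 3) n 0) n a 0) n (legSite (ctr 4 n) z' b)) (Dsh n)
              - comp (Dsh n) (diagK fun z' b => (n : ℝ) ^ 4 / 2 * bmGaugeAt (ctr 4 n) (colH (KInvStep (d := 3) n 0) n a 0) n (legSite (ctr 4 n) z' b)))
          - comp (comp (diagK fun z' b => (n : ℝ) ^ 4 / 2 * bmGaugeAt (ctr 4 n) (colH (KInvStep (d := 3) n 0) n a 0) n (legSite (ctr 4 n) z' b)) (Dsh n)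
              - comp (Dsh n) (diagK fun z' b => (n : ℝ) ^ 4 / 2 * bmGaugeAt (ctr 4 n) (colH (KInvStep (d := 3) n 0) n a 0) n (legSite (ctr 4 n) z' b)))
            (diagK fun z' b => (n : ℝ) ^ 4 / 2 * bmGaugeAt (ctr 4 n) (colH (KInvStep (d := 3) n 0) n e z₀) n (legSite (ctr 4 n) z' b))))
      ((1 / 2 : ℝ) * (2 * (((4 * (MG163 (3 + 1) * periodConst (kappa163 (3 + 1)) 3) * Real.exp (kappa163 (3 + 1) / ((3 : ℝ) + 1))) * Real.exp (kappa163 (3 + 1) / ((3 : ℝ) + 1) / 2)) * ((4 * (MG163 (3 + 1) * periodConst (kappa163 (3 + 1)) 3) * Real.exp (kappa163 (3 + 1) / ((3 : ℝ) + 1))) * Real.exp (kappa163 (3 + 1) / ((3 : ℝ) + 1) / 2)) * (Real.exp (2 * (kappa163 (3 + 1) / ((3 : ℝ) + 1))) + 1) ^ 2 * (4 * (2 * (Si * ((n : ℝ) ^ (3 + 1) * (((3 : ℝ) + 1) * n)) + Sf * (((3 : ℝ) + 1) * ((((3 : ℕ) : ℝ) + 1) * (n : ℝ) ^ (3 + 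1))))))
          * Zl 4 (kappa163 (3 + 1) / ((3 : ℝ) + 1) / 8))))
      (kappa163 (3 + 1) / ((3 : ℝ) + 1) / 8) := by
  have hn0 : (0 : ℝ) < n := by exact_mod_cast Nat.pos_of_ne_zero (NeZero.ne n)
  have hκ : 0 < kappa163 (3 + 1) / ((3 : ℝ) + 1) := by have := kappa163_pos (3 + 1); positivity
  have hC : 0 ≤ ((4 * (MG163 (3 + 1) * periodConst (kappa163 (3 + 1)) 3) * Real.exp (kappa163 (3 + 1) / ((3 : ℝ) + 1))) * Real.exp (kappa163 (3 + 1) / ((3 : ℝ) + 1) / 2)) := by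
    have h := abs_lockedWeight_legSite_le (n := n) a 0 0 (Sum.inl 0)
    rw [smul_zero, sub_zero, show l1 (0 : Site (3 + 1)) = 0 by simp [B12Sec2to5.l1], mul_zero, Real.exp_zero, mul_one] at h
    exact (abs_nonneg _).trans h
  have hδ : 0 < kappa163 (3 + 1) / ((3 : ℝ) + 1) / (((3 : ℝ) + 1) * n) := by positivity
  have h := decay510_half_tadpole_word_split (n := n) hSi hSf hsym hcolI hcolF
    (fun z' b => (n : ℝ) ^ 4 / 2 * bmGaugeAt (ctr 4 n) (colH (KInvStep (d := 3) n 0) n a 0) n (legSite (ctr 4 n) z' b))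
    (fun z₀ z' b => (n : ℝ) ^ 4 / 2 * bmGaugeAt (ctr 4 n) (colH (KInvStep (d := 3) n 0) n e z₀) n (legSite (ctr 4 n) z' b))
    hC hC hδ (fun x b => abs_lockedWeight_legSite_le (n := n) a 0 x b) (fun z₀ x b => abs_lockedWeight_legSite_le (n := n) e z₀ x b)
  have e1 : kappa163 (3 + 1) / ((3 : ℝ) + 1) / (((3 : ℝ) + 1) * n) * (((3 : ℝ) + 1) * (2 * n)) = 2 * (kappa163 (3 + 1) / ((3 : ℝ) + 1)) := by field_simp
  have e2 : kappa163 (3 + 1) / ((3 : ℝ) + 1) / (((3 : ℝ) + 1) * n) / 2 * n = kappa163 (3 + 1) / ((3 : ℝ) + 1) / 8 := by field_simp; ring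
  rwa [e1, e2] at h

/-- [folklore] The dressed `ℋ`-column INSIDE a block, without its decay factor: on a bond `(κ, u)` with both endpoints in one block,
`|colH G₀ n μ y κ u| ≤ (n⁵)⁻¹·8·MD·pC·e^{κ₁₆₃(4)∕4}` — my lineage's L-h♭ `DressedColumnRibbon.abs_colH_G₀_road_interior_le` (g30: the ribbon of plaquettes × the straight column's
gradient letter `MinimiserColumnGradient`), ONE POWER BELOW the face-sheet envelope of §7. -/
theorem abs_colH_G₀_interior_le_const (μ : Fin (3 + 1)) (y : Fin (3 + 1) → ℤ) (κ : Fin (3 + 1)) (u : Fin (3 + 1) → ℤ)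
    (hblk : blk n (u + unitVec κ) = blk n u) :
    |colH (coDressKBmAt (ctr 4 n) n (KInvStep (d := 3) n 0)) n μ y κ u| ≤ (((n : ℝ) ^ 5)⁻¹ * (8 * (MD163 4 * periodConst (kappa163 4) 3) * Real.exp (kappa163 4 / 4))) := by
  obtain ⟨m, rfl⟩ : ∃ m, n = m + 1 := Nat.exists_eq_succ_of_ne_zero (NeZero.ne n)
  have hr := ctrOff_mem_box (d := 3 + 1) (Nat.le_add_left 1 m)
  have hn0 : (0 : ℝ) < ((m + 1 : ℕ) : ℝ) := by positivity
  have hMP : 0 ≤ (MD163 4 * periodConst (kappa163 4) 3) * Real.exp (kappa163 4 / 4) :=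
    (mul_nonneg_iff_of_pos_left (by positivity)).1 (colH_KInvStep_zero_diff_road_weight_nonneg m)
  have hMP' : 0 ≤ MD163 4 * periodConst (kappa163 4) 3 := (mul_nonneg_iff_of_pos_right (Real.exp_pos _)).1 hMP
  have hC : 0 ≤ ((((m + 1 : ℕ) : ℝ) ^ 5)⁻¹ * (8 * (MD163 4 * periodConst (kappa163 4) 3) * Real.exp (kappa163 4 / 4))) :=
    mul_nonneg (by positivity) (mul_nonneg (mul_nonneg (by norm_num) hMP') (Real.exp_pos _).le)
  have h := abs_colH_G₀_road_interior_le m hr μ y κ u hblk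
  refine h.trans (mul_le_of_le_one_right hC (Real.exp_le_one_iff.2 ?_))
  have := kappa163_pos 4
  have : 0 ≤ kappa163 4 / 4 / (4 * ((m + 1 : ℕ) : ℝ)) * l1 (u - ((m + 1 : ℕ) : ℤ) • y) := mul_nonneg (by positivity) (l1_nonneg _)
  linarith

/-- **THE HEAD's ROW (dd) AT ITS OWN PIN IS A (5.10)-KERNEL WITH AN `n`-FREE CONSTANT** [our objects + folklore] — the face split closes the one power of `n` of §7:
`Decay510 (z₀ ↦ ½·tadpole G₀ ([Λc e z₀, [Λc a 0, Dsh n]])) (32·(C_int′ + 4·C_G′)·(Cλe^{κ′∕2})²·(e^{2κ′}+1)²·Zl 4 (κ′∕8)) (κ′∕8)` for `G₀ = coDressKBmAt (ctr 4 n) n (KInvStep 3 n 0)`,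
`C_int′ = 8·MD163 4·periodConst (κ₁₆₃ 4) 3·e^{κ₁₆₃(4)∕4}` (interior: `DressedColumnRibbon`), `C_G′ = C₄·(1 + 8(1 + e^{κ₁₆₃(4)∕4}))·e^{κ₁₆₃(4)∕4}` (faces: `PackedColumnEnvelope`), `Cλ = 4C₄e^{κ′}`,
`κ′ = κ₁₆₃(4)∕4` — HYPOTHESIS-FREE; NO power of `n`: interior bonds pay `n⁻⁵ × (Dsh block mass n⁵)`, face bonds `n⁻⁴ × (Dsh face mass n⁴)` (`(n⁵)⁻¹·(n⁴·4n) = 4`,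
`(n⁴)⁻¹·(4·(4·n⁴)) = 16` by `field_simp; ring`).  ONE displayed row of the HEAD, m-uniform in the sense `ChartDefectHeadScales` asks (constant bound before `m`);
NOT the HEAD, NOT a binder. -/
theorem decay510_row_dd_road_uniform (a e : Fin 4) :
    Decay510 (fun z₀ : Site 4 => (1 / 2 : ℝ) * tadpole (coDressKBmAt (ctr 4 n) n (KInvStep (d := 3) n 0))
        (comp (diagK fun z' b => (n : ℝ) ^ 4 / 2 * bmGaugeAt (ctr 4 n) (colH (KInvStep (d := 3) n 0) n e z₀) n (legSite (ctr 4 n) z' b))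
            (comp (diagK fun z' b => (n : ℝ) ^ 4 / 2 * bmGaugeAt (ctr 4 n) (colH (KInvStep (d := 3) n 0) n a 0) n (legSite (ctr 4 n) z' b)) (Dsh n)
              - comp (Dsh n) (diagK fun z' b => (n : ℝ) ^ 4 / 2 * bmGaugeAt (ctr 4 n) (colH (KInvStep (d := 3) n 0) n a 0) n (legSite (ctr 4 n) z' b)))
          - comp (comp (diagK fun z' b => (n : ℝ) ^ 4 / 2 * bmGaugeAt (ctr 4 n) (colH (KInvStep (d := 3) n 0) n a 0) n (legSite (ctr 4 n) z' b)) (Dsh n)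
              - comp (Dsh n) (diagK fun z' b => (n : ℝ) ^ 4 / 2 * bmGaugeAt (ctr 4 n) (colH (KInvStep (d := 3) n 0) n a 0) n (legSite (ctr 4 n) z' b)))
            (diagK fun z' b => (n : ℝ) ^ 4 / 2 * bmGaugeAt (ctr 4 n) (colH (KInvStep (d := 3) n 0) n e z₀) n (legSite (ctr 4 n) z' b))))
      (32 * ((8 * (MD163 4 * periodConst (kappa163 4) 3) * Real.exp (kappa163 4 / 4)) + 4 * ((MG163 4 * periodConst (kappa163 4) 3) * (1 + 8 * (1 + Real.exp (kappa163 4 / 4))) * Real.exp (kappa163 4 / 4)))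
        * ((((4 * (MG163 (3 + 1) * periodConst (kappa163 (3 + 1)) 3) * Real.exp (kappa163 (3 + 1) / ((3 : ℝ) + 1))) * Real.exp (kappa163 (3 + 1) / ((3 : ℝ) + 1) / 2)) * ((4 * (MG163 (3 + 1) * periodConst (kappa163 (3 + 1)) 3) * Real.exp (kappa163 (3 + 1) / ((3 : ℝ) + 1))) * Real.exp (kappa163 (3 + 1) / ((3 : ℝ) + 1) / 2)) * (Real.exp (2 * (kappa163 (3 + 1) / ((3 : ℝ) + 1))) + 1) ^ 2) * Zl 4 (kappa163 (3 + 1) / ((3 : ℝ) + 1) / 8)))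
      (kappa163 (3 + 1) / ((3 : ℝ) + 1) / 8) := by
  have hn0 : (n : ℝ) ≠ 0 := by exact_mod_cast NeZero.ne n
  have hnpos : (0 : ℝ) < n := by exact_mod_cast Nat.pos_of_ne_zero (NeZero.ne n)
  have hSf : 0 ≤ (((n : ℝ) ^ 4)⁻¹ * ((MG163 4 * periodConst (kappa163 4) 3) * (1 + 8 * (1 + Real.exp (kappa163 4 / 4))) * Real.exp (kappa163 4 / 4))) := (abs_nonneg _).trans (abs_colH_G₀_le_const (n := n) 0 0 0 0)
  have hGp : 0 ≤ ((MG163 4 * periodConst (kappa163 4) 3) * (1 + 8 * (1 + Real.exp (kappa163 4 / 4))) * Real.exp (kappa163 4 / 4)) := (mul_nonneg_iff_of_pos_left (by positivity)).1 hSf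
  have hMP : 0 ≤ (MD163 4 * periodConst (kappa163 4) 3) * Real.exp (kappa163 4 / 4) := by
    obtain ⟨m, hm⟩ : ∃ m, n = m + 1 := Nat.exists_eq_succ_of_ne_zero (NeZero.ne n)
    exact (mul_nonneg_iff_of_pos_left (by positivity)).1 (colH_KInvStep_zero_diff_road_weight_nonneg m)
  have hMP' : 0 ≤ MD163 4 * periodConst (kappa163 4) 3 := (mul_nonneg_iff_of_pos_right (Real.exp_pos _)).1 hMP
  have hSi : 0 ≤ (((n : ℝ) ^ 5)⁻¹ * (8 * (MD163 4 * periodConst (kappa163 4) 3) * Real.exp (kappa163 4 / 4))) :=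
    mul_nonneg (by positivity) (mul_nonneg (mul_nonneg (by norm_num) hMP') (Real.exp_pos _).le)
  have hsym : trK (coDressKBmAt (ctr 4 n) n (KInvStep (d := 3) n 0)) = sgnK (coDressKBmAt (ctr 4 n) n (KInvStep (d := 3) n 0)) :=
    trK_coDressKBmAt_KInvStep (d := 3) (ctrOff_mem_box (d := 3 + 1) (Nat.one_le_iff_ne_zero.2 (NeZero.ne n))) 0
  have h := decay510_row_dd_split (n := n) hSi hSf hsym
    (fun μ Y κ u hI => abs_colH_G₀_interior_le_const (n := n) μ Y κ u hI) (fun μ Y κ u => abs_colH_G₀_le_const (n := n) μ Y κ u) a e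
  refine decay510_mono_const h (le_of_eq ?_)
  field_simp
  ring

/-- **THE HEAD's ROW (dd) BINDER SHAPES AT ITS OWN PIN, `n`-FREE, HYPOTHESIS-FREE** [our objects + folklore] (`ChartDefectHead`'s `hAdd` ∕ `hBdd` and the constant of
`ChartDefectHeadScales` for this row): (i) `∀ a e, AbsMoment₂ (z₀ ↦ ½·tadpole G₀ ([Λc e z₀, [Λc a 0, Dsh n]]))`;
(ii) `|secondMoment (a e z₀ ↦ …) μ ν| ≤ (32·(C_int′ + 4·C_G′)·(Cλe^{κ′∕2})²·(e^{2κ′}+1)²·Zl 4 (κ′∕8))·Σ'_x |x|₁² e^{−(κ′∕8)|x|₁}` — every symbol n-free. -/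
theorem row_dd_road_uniform (μ ν : Fin 4) :
    (∀ a e : Fin 4, AbsMoment₂ (fun z₀ : Site 4 => (1 / 2 : ℝ) * tadpole (coDressKBmAt (ctr 4 n) n (KInvStep (d := 3) n 0))
        (comp (diagK fun z' b => (n : ℝ) ^ 4 / 2 * bmGaugeAt (ctr 4 n) (colH (KInvStep (d := 3) n 0) n e z₀) n (legSite (ctr 4 n) z' b))
            (comp (diagK fun z' b => (n : ℝ) ^ 4 / 2 * bmGaugeAt (ctr 4 n) (colH (KInvStep (d := 3) n 0) n a 0) n (legSite (ctr 4 n) z' b)) (Dsh n)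
              - comp (Dsh n) (diagK fun z' b => (n : ℝ) ^ 4 / 2 * bmGaugeAt (ctr 4 n) (colH (KInvStep (d := 3) n 0) n a 0) n (legSite (ctr 4 n) z' b)))
          - comp (comp (diagK fun z' b => (n : ℝ) ^ 4 / 2 * bmGaugeAt (ctr 4 n) (colH (KInvStep (d := 3) n 0) n a 0) n (legSite (ctr 4 n) z' b)) (Dsh n)
              - comp (Dsh n) (diagK fun z' b => (n : ℝ) ^ 4 / 2 * bmGaugeAt (ctr 4 n) (colH (KInvStep (d := 3) n 0) n a 0) n (legSite (ctr 4 n) z' b)))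
            (diagK fun z' b => (n : ℝ) ^ 4 / 2 * bmGaugeAt (ctr 4 n) (colH (KInvStep (d := 3) n 0) n e z₀) n (legSite (ctr 4 n) z' b))))) ∧
      |B12Beta.secondMoment (fun (a e : Fin 4) (z₀ : Site 4) => (1 / 2 : ℝ) * tadpole (coDressKBmAt (ctr 4 n) n (KInvStep (d := 3) n 0))
        (comp (diagK fun z' b => (n : ℝ) ^ 4 / 2 * bmGaugeAt (ctr 4 n) (colH (KInvStep (d := 3) n 0) n e z₀) n (legSite (ctr 4 n) z' b))
            (comp (diagK fun z' b => (n : ℝ) ^ 4 / 2 * bmGaugeAt (ctr 4 n) (colH (KInvStep (d := 3) n 0) n a 0) n (legSite (ctr 4 n) z' b)) (Dsh n)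
              - comp (Dsh n) (diagK fun z' b => (n : ℝ) ^ 4 / 2 * bmGaugeAt (ctr 4 n) (colH (KInvStep (d := 3) n 0) n a 0) n (legSite (ctr 4 n) z' b)))
          - comp (comp (diagK fun z' b => (n : ℝ) ^ 4 / 2 * bmGaugeAt (ctr 4 n) (colH (KInvStep (d := 3) n 0) n a 0) n (legSite (ctr 4 n) z' b)) (Dsh n)
              - comp (Dsh n) (diagK fun z' b => (n : ℝ) ^ 4 / 2 * bmGaugeAt (ctr 4 n) (colH (KInvStep (d := 3) n 0) n a 0) n (legSite (ctr 4 n) z' b)))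
            (diagK fun z' b => (n : ℝ) ^ 4 / 2 * bmGaugeAt (ctr 4 n) (colH (KInvStep (d := 3) n 0) n e z₀) n (legSite (ctr 4 n) z' b)))) μ ν|
        ≤ (32 * ((8 * (MD163 4 * periodConst (kappa163 4) 3) * Real.exp (kappa163 4 / 4)) + 4 * ((MG163 4 * periodConst (kappa163 4) 3) * (1 + 8 * (1 + Real.exp (kappa163 4 / 4))) * Real.exp (kappa163 4 / 4)))
        * ((((4 * (MG163 (3 + 1) * periodConst (kappa163 (3 + 1)) 3) * Real.exp (kappa163 (3 + 1) / ((3 : ℝ) + 1))) * Real.exp (kappa163 (3 + 1) / ((3 : ℝ) + 1) / 2)) * ((4 * (MG163 (3 + 1) * periodConst (kappa163 (3 + 1)) 3) * Real.exp (kappa163 (3 + 1) / ((3 : ℝ) + 1))) * Real.exp (kappa163 (3 + 1) / ((3 : ℝ) + 1) / 2)) * (Real.exp (2 * (kappa163 (3 + 1) / ((3 : ℝ) + 1))) + 1) ^ 2) * Zl 4 (kappa163 (3 + 1) / ((3 : ℝ) + 1) / 8)))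
          * ∑' x : Site 4, l1 x ^ 2 * Real.exp (-(kappa163 (3 + 1) / ((3 : ℝ) + 1) / 8) * l1 x) := by
  have hr : 0 < kappa163 (3 + 1) / ((3 : ℝ) + 1) / 8 := by have := kappa163_pos (3 + 1); positivity
  have hd := fun a e => decay510_row_dd_road_uniform (n := n) a e
  refine ⟨fun a e => absMoment₂_of_decay510 hr (hd a e), ?_⟩
  exact (secondMoment_abs_le_of_decay510 (P := fun (a e : Fin 4) (z₀ : Site 4) => (1 / 2 : ℝ) * tadpole (coDressKBmAt (ctr 4 n) n (KInvStep (d := 3) n 0))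
        (comp (diagK fun z' b => (n : ℝ) ^ 4 / 2 * bmGaugeAt (ctr 4 n) (colH (KInvStep (d := 3) n 0) n e z₀) n (legSite (ctr 4 n) z' b))
            (comp (diagK fun z' b => (n : ℝ) ^ 4 / 2 * bmGaugeAt (ctr 4 n) (colH (KInvStep (d := 3) n 0) n a 0) n (legSite (ctr 4 n) z' b)) (Dsh n)
              - comp (Dsh n) (diagK fun z' b => (n : ℝ) ^ 4 / 2 * bmGaugeAt (ctr 4 n) (colH (KInvStep (d := 3) n 0) n a 0) n (legSite (ctr 4 n) z' b)))
          - comp (comp (diagK fun z' b => (n : ℝ) ^ 4 / 2 * bmGaugeAt (ctr 4 n) (colH (KInvStep (d := 3) n 0) n a 0) n (legSite (ctr 4 n) z' b)) (Dsh n)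
              - comp (Dsh n) (diagK fun z' b => (n : ℝ) ^ 4 / 2 * bmGaugeAt (ctr 4 n) (colH (KInvStep (d := 3) n 0) n a 0) n (legSite (ctr 4 n) z' b)))
            (diagK fun z' b => (n : ℝ) ^ 4 / 2 * bmGaugeAt (ctr 4 n) (colH (KInvStep (d := 3) n 0) n e z₀) n (legSite (ctr 4 n) z' b)))) hr (hd μ ν)).2

end Uniform

end Summit.QuantumFields.BalabanUV.Beta.D1BFx.ChartDefectRowDdUniform

end
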